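import Summits.QuantumAdvantage.QuantumAdvantage.Theorems.OddPrimeWalkOddConfigAffine
import Summits.QuantumAdvantage.AdviceFreeQNC0.CleanGapStrategies

/-!
# Zero-sum pairs in a weight class of the cube `{0,1}^ℓ` (engine for item stmt-QuantumAdvantage-24030 `FarAffinePairLaw`)

Cell qa-qnc0, route OddPrimeWalk; planner qa-qnc0-p2 g29 ROUND-29 §4.4 (i) asked for the count of zero-sum class triples;
prover qn-prover-3 g18.

THEOREM (`three_mul_sq_card_cls_le`).  For `ℓ ≥ 64` and every class `C_a = {v ∈ {0,1}^ℓ : |v| ≡ a (mod 3)}`: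
`3·|C_a|² ≤ 10·#{(x, y) ∈ C_a × C_a : x ⊕ y ∈ C_a}` (the true ratio tends to `1/3`).

PROOF (elementary, no character sums beyond the tree's class-size bounds).  §1 classes, zero-sum pairs, the binomial identities
`Σ_v 2^{|v|} = Σ_v 2^{ℓ−|v|} = 3^ℓ` (`Fintype.prod_sum`), class sizes `2^ℓ − 2 ≤ 3|C_a| ≤ 2^ℓ + 2` (tree:
`three_mul_card_class_add_two_ge`, `abs_three_mul_card_filter_mod_sub_card_le`).  §2 DEGREE BOUND `pow_le_zdeg`: for `x` with
support `S`, `|S| = s`, the pairs `(g, g')` of sub-cube vectors on `S` / `Sᶜ` with `|g| ≡ 2s`, `|g'| ≡ a + s` embed injectively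
(`extS`, extension by zero through `Finset.equivFin`) into the zero-sum partners `{y ∈ C_a : x ⊕ y ∈ C_a}` (`|y| = |g| + |g'|`,
`|x ⊕ y| = (s − |g|) + |g'|`), whence `2^ℓ ≤ 9·zdeg(x) + 6·2^s + 6·2^{ℓ−s} + 4`.  §3 summing over `x ∈ C_a`:
`|C_a|·2^ℓ ≤ 9·|zsum| + 12·3^ℓ + 4|C_a|`, and `360·3^ℓ + 140·2^ℓ + 36 ≤ 4^ℓ` (`ℓ ≥ 64`) closes the estimate.
WHAT THIS IS NOT: pure cube combinatorics; nothing about strategies; separation NOT moved.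
-/

namespace Summit.QuantumAdvantage.AdviceFreeQNC0.OddConfig

open Finset Classical

variable {ℓ : ℕ}

/-! ### §1 The cube `{0,1}^ℓ`: classes, zero-sum pairs, the binomial identity `Σ_v 2^{|v|} = 3^ℓ` -/

/-- the weight class `a` (mod 3) of the cube `{0,1}^ℓ`. -/
def cls (ℓ a : ℕ) : Finset (Fin ℓ → Bool) := univ.filter fun v : Fin ℓ → Bool => wt v % 3 = a

/-- the ZERO-SUM PAIRS of class `a`: ordered pairs `(x, y)` with `x, y, x ⊕ y` all in class `a`. -/
def zsum (ℓ a : ℕ) : Finset ((Fin ℓ → Bool) × (Fin ℓ → Bool)) :=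
  ((cls ℓ a) ×ˢ (cls ℓ a)).filter fun p => addV p.1 p.2 ∈ cls ℓ a

/-- the number of zero-sum partners of `x` in class `a`. -/
def zdeg (ℓ a : ℕ) (x : Fin ℓ → Bool) : ℕ := ((cls ℓ a).filter fun y => addV x y ∈ cls ℓ a).card

/-- every class of the cube has at most `(2^ℓ + 2)/3` members. -/
theorem three_mul_card_cls_le (ℓ : ℕ) {a : ℕ} (ha : a < 3) : 3 * (cls ℓ a).card ≤ 2 ^ ℓ + 2 := by
  have h := abs_three_mul_card_filter_mod_sub_card_le (univ : Finset (Fin ℓ → Bool)) a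
  rw [norm_sum_omega3_pow_wt ℓ, Finset.card_univ, Fintype.card_fun, Fintype.card_bool,
    Fintype.card_fin] at h
  have hwt : ∀ v : Fin ℓ → Bool, Literature.Computability.MetaComplexity.Hegedus.wt v = wt v := fun v => rfl
  simp only [hwt, Nat.mod_eq_of_lt ha] at h
  have h' := (abs_le.1 h).2
  have hcast : ((3 * (cls ℓ a).card : ℕ) : ℝ) ≤ ((2 ^ ℓ + 2 : ℕ) : ℝ) := by
    unfold cls; push_cast; push_cast at h'; linarith
  exact_mod_cast hcast

/-- every class of the cube has at least `(2^ℓ - 2)/3` members. -/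
theorem pow_le_three_mul_card_cls (ℓ : ℕ) {a : ℕ} (ha : a < 3) : 2 ^ ℓ ≤ 3 * (cls ℓ a).card + 2 := by
  have h := three_mul_card_class_add_two_ge ℓ a
  rwa [Nat.mod_eq_of_lt ha] at h

/-- `2^{|v|}` as a product over the coordinates. -/
theorem two_pow_wt_eq_prod (v : Fin ℓ → Bool) : (2 : ℕ) ^ wt v = ∏ i, (if v i = true then 2 else 1) := by
  unfold wt
  rw [← prod_filter, prod_const]

/-- `2^{ℓ - |v|}` as a product over the coordinates. -/
theorem two_pow_sub_wt_eq_prod (v : Fin ℓ → Bool) :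
    (2 : ℕ) ^ (ℓ - wt v) = ∏ i, (if v i = true then 1 else 2) := by
  have hc : ℓ - wt v = (univ.filter fun i : Fin ℓ => ¬ v i = true).card := by
    have h := card_filter_add_card_filter_not (s := (univ : Finset (Fin ℓ))) (fun i => v i = true)
    rw [card_univ, Fintype.card_fin] at h
    unfold wt; omega
  rw [hc, ← prod_const, prod_filter]
  refine prod_congr rfl fun i _ => ?_
  by_cases h : v i = true <;> simp [h]

/-- the binomial identity `Σ_v 2^{|v|} = 3^ℓ`. -/
theorem sum_two_pow_wt (ℓ : ℕ) : ∑ v : Fin ℓ → Bool, (2 : ℕ) ^ wt v = 3 ^ ℓ := by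
  simp_rw [two_pow_wt_eq_prod]
  rw [← Fintype.prod_sum fun (i : Fin ℓ) (b : Bool) => if b = true then (2 : ℕ) else 1]
  simp

/-- the binomial identity `Σ_v 2^{ℓ - |v|} = 3^ℓ`. -/
theorem sum_two_pow_sub_wt (ℓ : ℕ) : ∑ v : Fin ℓ → Bool, (2 : ℕ) ^ (ℓ - wt v) = 3 ^ ℓ := by
  simp_rw [two_pow_sub_wt_eq_prod]
  rw [← Fintype.prod_sum fun (i : Fin ℓ) (b : Bool) => if b = true then (1 : ℕ) else 2]
  simp

/-! ### §2 The sub-cube injection along the support of `x` -/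

/-- extension by zero of a vector on the sub-cube indexed by `S`. -/
noncomputable def extS (S : Finset (Fin ℓ)) (g : Fin S.card → Bool) : Fin ℓ → Bool :=
  fun i => if h : i ∈ S then g (S.equivFin ⟨i, h⟩) else false

/-- coordinatewise complement. -/
def cpl {d : ℕ} (g : Fin d → Bool) : Fin d → Bool := fun j => !g j

/-- `extS S g` vanishes off `S`. -/
theorem extS_apply_not_mem {S : Finset (Fin ℓ)} (g : Fin S.card → Bool) {i : Fin ℓ} (h : i ∉ S) :
    extS S g i = false := by simp [extS, h]

/-- `extS S g` at a point of `S`. -/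
theorem extS_apply_mem {S : Finset (Fin ℓ)} (g : Fin S.card → Bool) {i : Fin ℓ} (h : i ∈ S) :
    extS S g i = g (S.equivFin ⟨i, h⟩) := by simp [extS, h]

/-- `extS S g` at the `j`-th point of `S`. -/
theorem extS_apply_symm {S : Finset (Fin ℓ)} (g : Fin S.card → Bool) (j : Fin S.card) :
    extS S g (S.equivFin.symm j).1 = g j := by
  rw [extS_apply_mem g (S.equivFin.symm j).2]
  congr 1
  rw [show (⟨(S.equivFin.symm j).1, (S.equivFin.symm j).2⟩ : {i // i ∈ S}) = S.equivFin.symm j from rfl]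
  exact S.equivFin.apply_symm_apply j

/-- the weight of an extension is the weight of the extended vector. -/
theorem wt_extS (S : Finset (Fin ℓ)) (g : Fin S.card → Bool) : wt (extS S g) = wt g := by
  unfold wt
  refine card_bij' (fun i hi => S.equivFin ⟨i, by
      by_contra h; have := (mem_filter.mp hi).2; rw [extS_apply_not_mem g h] at this; exact Bool.false_ne_true this⟩)
    (fun j _ => (S.equivFin.symm j).1) ?_ ?_ ?_ ?_
  · intro i hi
    have hi' := (mem_filter.mp hi).2
    have hS : i ∈ S := by
      by_contra h; rw [extS_apply_not_mem g h] at hi'; exact Bool.false_ne_true hi'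
    rw [extS_apply_mem g hS] at hi'
    exact mem_filter.mpr ⟨mem_univ _, hi'⟩
  · intro j hj
    have hj' := (mem_filter.mp hj).2
    exact mem_filter.mpr ⟨mem_univ _, by rw [extS_apply_symm]; exact hj'⟩
  · intro i hi; simp
  · intro j hj
    rw [show (⟨(S.equivFin.symm j).1, _⟩ : {i // i ∈ S}) = S.equivFin.symm j from rfl]
    exact S.equivFin.apply_symm_apply j

/-- the weight of the complement. -/
theorem wt_cpl {d : ℕ} (g : Fin d → Bool) : wt (cpl g) = d - wt g := by
  have h := card_filter_add_card_filter_not (s := (univ : Finset (Fin d))) (fun i => g i = true)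
  rw [card_univ, Fintype.card_fin] at h
  have e : (univ.filter fun i : Fin d => ¬ g i = true) = univ.filter fun i : Fin d => cpl g i = true := by
    ext i; simp [cpl]
  rw [e] at h
  unfold wt; omega

/-- weights add over disjointly supported extensions along `S` and `Sᶜ`. -/
theorem wt_addV_extS (S : Finset (Fin ℓ)) (g : Fin S.card → Bool) (g' : Fin Sᶜ.card → Bool) :
    wt (addV (extS S g) (extS Sᶜ g')) = wt g + wt g' := by
  rw [← wt_extS S g, ← wt_extS Sᶜ g']
  unfold wt
  rw [← card_union_of_disjoint]
  · congr 1
    ext i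
    simp only [mem_filter, mem_univ, true_and, mem_union, addV]
    by_cases h : i ∈ S
    · rw [extS_apply_not_mem g' (fun h' => (mem_compl.mp h') h)]; simp
    · rw [extS_apply_not_mem g h]; simp
  · rw [disjoint_filter]
    intro i _ h1 h2
    by_cases h : i ∈ S
    · rw [extS_apply_not_mem g' (fun h' => (mem_compl.mp h') h)] at h2; exact Bool.false_ne_true h2
    · rw [extS_apply_not_mem g h] at h1; exact Bool.false_ne_true h1

/-- the support of `x`. -/
def suppV (x : Fin ℓ → Bool) : Finset (Fin ℓ) := univ.filter fun i => x i = true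

/-- adding `x` to an extension along `supp x` complements the extended vector. -/
theorem addV_extS_suppV (x : Fin ℓ → Bool) (g : Fin (suppV x).card → Bool) (g' : Fin (suppV x)ᶜ.card → Bool) :
    addV x (addV (extS (suppV x) g) (extS (suppV x)ᶜ g')) =
      addV (extS (suppV x) (cpl g)) (extS (suppV x)ᶜ g') := by
  funext i
  simp only [addV]
  by_cases h : i ∈ suppV x
  · have hx : x i = true := (mem_filter.mp h).2
    rw [extS_apply_mem g h, extS_apply_mem (cpl g) h, hx]
    simp [cpl]
  · have hx : x i = false := by
      have : ¬ x i = true := fun hx => h (mem_filter.mpr ⟨mem_univ _, hx⟩)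
      simpa using this
    rw [extS_apply_not_mem g h, extS_apply_not_mem (cpl g) h, hx]
    simp

/-- the sub-cube embedding is injective. -/
theorem extS_pair_injective (S : Finset (Fin ℓ)) :
    Function.Injective fun p : (Fin S.card → Bool) × (Fin Sᶜ.card → Bool) =>
      addV (extS S p.1) (extS Sᶜ p.2) := by
  rintro ⟨g₁, g₂⟩ ⟨h₁, h₂⟩ heq
  simp only at heq
  have e1 : g₁ = h₁ := by
    funext j
    have hj : (S.equivFin.symm j).1 ∈ S := (S.equivFin.symm j).2
    have hjc : (S.equivFin.symm j).1 ∉ Sᶜ := fun h => (mem_compl.mp h) hj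
    have := congrFun heq (S.equivFin.symm j).1
    simp only [addV, extS_apply_symm, extS_apply_not_mem _ hjc, Bool.xor_false] at this
    exact this
  have e2 : g₂ = h₂ := by
    funext j
    have hj : (Sᶜ.equivFin.symm j).1 ∈ Sᶜ := (Sᶜ.equivFin.symm j).2
    have hjS : (Sᶜ.equivFin.symm j).1 ∉ S := mem_compl.mp hj
    have := congrFun heq (Sᶜ.equivFin.symm j).1
    simp only [addV, extS_apply_symm, extS_apply_not_mem _ hjS, Bool.false_xor] at this
    exact this
  rw [e1, e2]

/-- **Degree bound.**  For every `x` with `|x| = s`:  `2^ℓ ≤ 9·zdeg(x) + 6·2^s + 6·2^{ℓ-s} + 4` — the pairs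
`(g, g')` of sub-cube vectors along `supp x` / its complement with `|g| ≡ 2s`, `|g'| ≡ a + s` inject into the zero-sum partners. -/
theorem pow_le_zdeg (ℓ : ℕ) {a : ℕ} (ha : a < 3) (x : Fin ℓ → Bool) :
    2 ^ ℓ ≤ 9 * zdeg ℓ a x + 6 * 2 ^ wt x + 6 * 2 ^ (ℓ - wt x) + 4 := by
  have hScard : (suppV x).card = wt x := rfl
  have hSc : (suppV x)ᶜ.card = ℓ - wt x := by rw [card_compl, Fintype.card_fin, hScard]
  have hsl : wt x ≤ ℓ := by
    unfold wt; exact (card_filter_le _ _).trans (by rw [card_univ, Fintype.card_fin])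
  -- the injection of the sub-cube pairs into the zero-sum partners of `x`
  have hinj : ((univ.filter fun g : Fin (suppV x).card → Bool => wt g % 3 = (2 * wt x) % 3) ×ˢ
      (univ.filter fun g : Fin (suppV x)ᶜ.card → Bool => wt g % 3 = (a + wt x) % 3)).card
        ≤ zdeg ℓ a x := by
    unfold zdeg
    refine card_le_card_of_injOn (fun p => addV (extS (suppV x) p.1) (extS (suppV x)ᶜ p.2)) ?_
      ((extS_pair_injective (suppV x)).injOn)
    intro p hp
    have hp' := mem_product.mp (mem_coe.mp hp)
    have h1 : wt p.1 % 3 = (2 * wt x) % 3 := (mem_filter.mp hp'.1).2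
    have h2 : wt p.2 % 3 = (a + wt x) % 3 := (mem_filter.mp hp'.2).2
    have hle : wt p.1 ≤ (suppV x).card := by
      unfold wt; exact (card_filter_le _ _).trans (by rw [card_univ, Fintype.card_fin])
    rw [mem_coe, mem_filter]
    refine ⟨mem_filter.mpr ⟨mem_univ _, ?_⟩, mem_filter.mpr ⟨mem_univ _, ?_⟩⟩
    · rw [wt_addV_extS]; omega
    · rw [addV_extS_suppV x, wt_addV_extS, wt_cpl]; omega
  rw [card_product] at hinj
  have h1 := three_mul_card_class_add_two_ge (suppV x).card (2 * wt x)
  have h2 := three_mul_card_class_add_two_ge (suppV x)ᶜ.card (a + wt x)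
  have hb1 : (univ.filter fun g : Fin (suppV x).card → Bool => wt g % 3 = (2 * wt x) % 3).card
      ≤ 2 ^ (suppV x).card := by
    refine (card_filter_le _ _).trans ?_
    rw [card_univ, Fintype.card_fun, Fintype.card_bool, Fintype.card_fin]
  have hb2 : (univ.filter fun g : Fin (suppV x)ᶜ.card → Bool => wt g % 3 = (a + wt x) % 3).card
      ≤ 2 ^ (suppV x)ᶜ.card := by
    refine (card_filter_le _ _).trans ?_
    rw [card_univ, Fintype.card_fun, Fintype.card_bool, Fintype.card_fin]
  have hpow : 2 ^ ℓ = 2 ^ (suppV x).card * 2 ^ (suppV x)ᶜ.card := by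
    rw [← pow_add]; congr 1; omega
  have hmul := Nat.mul_le_mul h1 h2
  rw [hpow, ← hSc, ← hScard]
  nlinarith [hinj, hmul, hb1, hb2]

/-! ### §3 The zero-sum pair count -/

/-- `|zsum| = Σ_x zdeg(x)`. -/
theorem card_zsum_eq_sum (ℓ a : ℕ) : (zsum ℓ a).card = ∑ x ∈ cls ℓ a, zdeg ℓ a x := by
  unfold zsum zdeg
  rw [card_filter, sum_product]
  refine sum_congr rfl fun x _ => ?_
  rw [card_filter]

/-- summed degree bound: `|cls|·2^ℓ ≤ 9·|zsum| + 12·3^ℓ + 4·|cls|`. -/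
theorem card_cls_mul_pow_le (ℓ : ℕ) {a : ℕ} (ha : a < 3) :
    (cls ℓ a).card * 2 ^ ℓ ≤ 9 * (zsum ℓ a).card + 12 * 3 ^ ℓ + 4 * (cls ℓ a).card := by
  have h := sum_le_sum (s := cls ℓ a) fun x _ => pow_le_zdeg ℓ ha x
  rw [sum_const, smul_eq_mul] at h
  simp only [sum_add_distrib, ← mul_sum, sum_const, smul_eq_mul] at h
  rw [card_zsum_eq_sum]
  have e1 : (∑ x ∈ cls ℓ a, (2 : ℕ) ^ wt x) ≤ 3 ^ ℓ := by
    rw [← sum_two_pow_wt ℓ]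
    exact sum_le_sum_of_subset_of_nonneg (subset_univ _) fun _ _ _ => Nat.zero_le _
  have e2 : (∑ x ∈ cls ℓ a, (2 : ℕ) ^ (ℓ - wt x)) ≤ 3 ^ ℓ := by
    rw [← sum_two_pow_sub_wt ℓ]
    exact sum_le_sum_of_subset_of_nonneg (subset_univ _) fun _ _ _ => Nat.zero_le _
  linarith

/-- the exponential comparison used: `360·3^ℓ + 140·2^ℓ + 36 ≤ 4^ℓ` for `ℓ ≥ 64`. -/
theorem key_pow_ineq {ℓ : ℕ} (hℓ : 64 ≤ ℓ) : 360 * 3 ^ ℓ + 140 * 2 ^ ℓ + 36 ≤ 2 ^ ℓ * 2 ^ ℓ := by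
  induction ℓ, hℓ using Nat.le_induction with
  | base => norm_num
  | succ k _ ih =>
    have h3 : 3 ^ (k + 1) = 3 * 3 ^ k := by rw [pow_succ, mul_comm]
    have h2 : 2 ^ (k + 1) = 2 * 2 ^ k := by rw [pow_succ, mul_comm]
    rw [h3, h2]
    nlinarith [ih, Nat.zero_le (2 ^ k), Nat.zero_le (3 ^ k)]

/-- **ZERO-SUM PAIR COUNT** (cube form): for `ℓ ≥ 64` every class `a` of `{0,1}^ℓ` has
`3·|cls a|² ≤ 10·#{(x,y) : x, y, x ⊕ y ∈ cls a}` (the asymptotic ratio is `1/3`). -/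
theorem three_mul_sq_card_cls_le {ℓ a : ℕ} (hℓ : 64 ≤ ℓ) (ha : a < 3) :
    3 * ((cls ℓ a).card : ℝ) ^ 2 ≤ 10 * ((zsum ℓ a).card : ℝ) := by
  have H1 : ((cls ℓ a).card : ℝ) * (2 : ℝ) ^ ℓ ≤
      9 * ((zsum ℓ a).card : ℝ) + 12 * (3 : ℝ) ^ ℓ + 4 * ((cls ℓ a).card : ℝ) := by
    exact_mod_cast card_cls_mul_pow_le ℓ ha
  have H2 : (2 : ℝ) ^ ℓ ≤ 3 * ((cls ℓ a).card : ℝ) + 2 := by exact_mod_cast pow_le_three_mul_card_cls ℓ ha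
  have H3 : 3 * ((cls ℓ a).card : ℝ) ≤ (2 : ℝ) ^ ℓ + 2 := by exact_mod_cast three_mul_card_cls_le ℓ ha
  have H4 : 360 * (3 : ℝ) ^ ℓ + 140 * (2 : ℝ) ^ ℓ + 36 ≤ (2 : ℝ) ^ ℓ * (2 : ℝ) ^ ℓ := by
    exact_mod_cast key_pow_ineq hℓ
  set c : ℝ := ((cls ℓ a).card : ℝ)
  set X : ℝ := (2 : ℝ) ^ ℓ
  have hc0 : 0 ≤ c := Nat.cast_nonneg _
  have hX0 : 0 ≤ X := by positivity
  have h5 : 3 * c ^ 2 ≤ c * X + 2 * c := by nlinarith [mul_le_mul_of_nonneg_left H3 hc0]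
  have h6 : X * X - 2 * X ≤ 3 * (c * X) := by nlinarith [mul_le_mul_of_nonneg_left H2 hX0]
  have hX1 : (1 : ℝ) ≤ X := one_le_pow₀ (by norm_num)
  nlinarith [H1, h5, h6, H4, hX1, H3]

end Summit.QuantumAdvantage.AdviceFreeQNC0.OddConfig
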